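import Mathlib
import HarnessLib
import Summits.CriticalPhenomena.PercolationContinuityZ3.Theses.PercLowPointHalfSpace
import Summits.CriticalPhenomena.PercolationContinuityZ3.Theorems.PercLowPointHalfSpaceLowPointIdentity
import Summits.CriticalPhenomena.PercolationContinuityZ3.Theorems.PercLowPointHalfSpaceBoundaryTwoArmDecayStubCensusDefs
import Literature.Probability.Percolation.HalfSpacePinnedPairs

/-!
# Crux `LowPointBookkeeping` (stmt-CriticalPhenomena-14713): the pair-free point-to-wall
# mass-transport identity `P_p(h e₀ ↔ ∂ℍ in ℍ) = E_p[N_h(U)/|U ∩ ∂ℍ|]`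

Helper file for the crux item `stmt-CriticalPhenomena-14713` (`LowPointBookkeeping`, K) of route
`CriticalPhenomena/PercLowPointHalfSpace` (lands `--supports stmt-CriticalPhenomena-14713`, registered
stub `stub_pointToWallIdentity`; line `SketchIdeator1`, lead c4).  K := A → B → C →
[`P_{p_c}(0 ↔ n e₀) → 0`]; its conclusion is the conjunct `θ(p_c(ℤ³)) = 0`.  Every proof of K has to
convert the BULK lower bound `θ(p_c) ≤ P_{p_c}(h e₀ ↔ ∂ℍ in ℍ)` (an infinite open path from
`h e₀ = (h,0,0)` leaves `ℍ = {0 ≤ x₀}` through the floor, all half-space clusters being finite at `p_c`,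
Barsky–Grimmett–Newman) into a statement about the WALL-ROOTED cluster `U = C_ℍ(0)` that A, B, C speak
about.  This file proves the canonical pair-free, parameter-free conversion:

* `LowPoint.finite_cl_halfSpace` (deterministic): if all shifted half-space clusters of `ω` are finite
  then the `ℍ`-cluster of every point of `ℍ` is finite (lowest level + re-rooting);
* `LowPoint.measure_wallConn_eq_lintegral_levelCount` = `stub_pointToWallIdentity` — **point-to-wall
  identity**: for `p ≤ p_c(ℤ³)` and every `h : ℕ`,
  `P_p(h e₀ ↔ ∂ℍ in ℍ) = ∫ N_h(U) / |U ∩ ∂ℍ| dP_p`, `N_h(U) = |U ∩ {x₀ = h}|` the level-`h` slice of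
  the wall cluster of the origin and `|U ∩ ∂ℍ|` its footprint.  Proof: send mass `1/|C_ℍ(y) ∩ ∂ℍ|`
  from each floor point `y` of the `ℍ`-cluster of `x + h e₀` to the floor point `x`; the mass-transport
  principle for the horizontal translations (`BoundaryTwoArmDecay.stub_census_floorMTP`, landed) equates
  the expected mass received at `0` — the indicator of `{h e₀ ↔ ∂ℍ in ℍ}`, a.s. — with the expected mass
  sent from `0` — `N_h(U)/|U ∩ ∂ℍ|`.

The companion file `PercLowPointHalfSpaceLowPointBookkeepingLevelCount.lean` adds
`θ(p_c) ≤ P_{p_c}(h e₀ ↔ ∂ℍ in ℍ)`, the converse one-arm bound, and the level-count form of K: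
`K ⟺ (A → B → C → E_{p_c}[N_h(U)/|U ∩ ∂ℍ|] → 0)`.

Sources: G. Grimmett, *Percolation* (1999), Thm. (7.35) (Barsky–Grimmett–Newman), §1.6 (translation
invariance); R. Lyons – Y. Peres, *Probability on Trees and Networks* (2016), §8.2 (mass transport).
-/

noncomputable section

namespace Summit.CriticalPhenomena.PercolationContinuityZ3.Theorems

open MeasureTheory Filter Topology
open Literature.Probability.Percolation Literature.Probability.LatticeModels
open scoped ENNReal

namespace LowPoint

/-- The shift `ω ↦ ω + s` of bond configurations of `ℤ³` (local notation). -/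
local notation3 (prettyPrint := false) "𝑻[" s "]" => BondConfig.relabel (sym2Equiv (Site.shift s))

/-- The point `h e₀ = (h, 0, 0)` on the normal axis (local notation). -/
local notation3 (prettyPrint := false) "𝐏[" h "]" => (Pi.single 0 ((h : ℕ) : ℤ) : Site 3)

/-- The `ℍ`-cluster `C_ℍ(a) = {u | a ↔ u in ℍ}` of a vertex `a` (local notation). -/
local notation3 (prettyPrint := false) "𝐜𝐥[" ω ", " a "]" =>
  ({u : Site 3 | ω ∈ openConnIn (halfSpace 3) a u} : Set (Site 3))

/-- The mass-transport weight `1/|C_ℍ(a) ∩ ∂ℍ|` (local notation). -/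
local notation3 (prettyPrint := false) "𝐰𝐭[" ω ", " a "]" =>
  (((Set.encard ({u : Site 3 | ω ∈ openConnIn (halfSpace 3) a u} ∩ {u : Site 3 | u 0 = 0}) : ℕ∞) :
    ℝ≥0∞))⁻¹

/-! ## Deterministic part: finiteness of `ℍ`-clusters and the wall connection of an infinite cluster -/

section Deterministic

/-- The `ℍ`-cluster of a floor-level root `w` inside the level half-space `{w₀ ≤ x₀}` is a translate
of the half-space cluster of the origin of `ω - w`; in particular it is finite when the latter is.
[folklore] -/
theorem setOf_conn_level_eq_preimage (ω : BondConfig (Site 3)) (w : Site 3) :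
    {u : Site 3 | ω ∈ openConnIn {x : Site 3 | w 0 ≤ x 0} w u} =
      (fun u : Site 3 => u - w) ⁻¹' halfSpaceCluster (𝑻[-w] ω) := by
  ext u
  rw [Set.mem_preimage, mem_halfSpaceCluster_shift_iff]
  simp only [Set.mem_setOf_eq, Pi.neg_apply, neg_neg, sub_neg_eq_add, sub_add_cancel]

/-- **Every `ℍ`-cluster is finite** once all shifted half-space clusters of `ω` are finite: the
`ℍ`-cluster of `a ∈ ℍ` has a lowest level `l₀ ≥ 0` and equals the cluster, inside `{l₀ ≤ x₀}`, of
any of its points `w` at level `l₀`, i.e. a translate of the half-space cluster of `ω - w`.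
[folklore] -/
theorem finite_cl_halfSpace {ω : BondConfig (Site 3)}
    (hfin : ∀ v : Site 3, (halfSpaceCluster (𝑻[v] ω)).Finite) {a : Site 3} (ha : 0 ≤ a 0) :
    (𝐜𝐥[ω, a]).Finite := by
  have haH : a ∈ halfSpace 3 := ha
  -- levels of the cluster, as natural numbers
  have hex : ∃ n : ℕ, ∃ u : Site 3, ω ∈ openConnIn (halfSpace 3) a u ∧ u 0 = n :=
    ⟨(a 0).toNat, a, conn_refl ω haH, (Int.toNat_of_nonneg ha).symm⟩
  classical
  obtain ⟨w, hw, hw0⟩ := Nat.find_spec hex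
  have hmin : ∀ u : Site 3, ω ∈ openConnIn (halfSpace 3) a u → w 0 ≤ u 0 := by
    intro u hu
    have hu0 : 0 ≤ u 0 := hu.2.1
    have h1 : Nat.find hex ≤ (u 0).toNat :=
      Nat.find_min' hex ⟨u, hu, (Int.toNat_of_nonneg hu0).symm⟩
    rw [hw0]
    calc ((Nat.find hex : ℕ) : ℤ) ≤ ((u 0).toNat : ℤ) := by exact_mod_cast h1
      _ = u 0 := Int.toNat_of_nonneg hu0
  have hwH : w ∈ halfSpace 3 := hw.2.1
  -- the whole `ℍ`-cluster of `w` (= that of `a`) lies in `{w₀ ≤ x₀}`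
  have hsubS' : openClusterIn (withinGraph ⊤ (halfSpace 3)) ω w ⊆ {x : Site 3 | w 0 ≤ x 0} := by
    intro u hu
    exact hmin u (conn_trans hw ((conn_iff_mem_cluster hwH).2 hu))
  have hsub : 𝐜𝐥[ω, a] ⊆ (fun u : Site 3 => u - w) ⁻¹' halfSpaceCluster (𝑻[-w] ω) := by
    intro u hu
    rw [← setOf_conn_level_eq_preimage, Set.mem_setOf_eq]
    have hwu : ω ∈ openConnIn (halfSpace 3) w u := conn_trans (conn_symm hw) hu
    have hwu' : u ∈ openClusterIn (withinGraph ⊤ {x : Site 3 | w 0 ≤ x 0}) ω w :=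
      cluster_subset_of_subset hsubS' ((conn_iff_mem_cluster hwH).1 hwu)
    exact (conn_iff_mem_cluster (show w ∈ {x : Site 3 | w 0 ≤ x 0} from le_refl (w 0))).2 hwu'
  exact ((hfin (-w)).preimage sub_left_injective.injOn).subset hsub

end Deterministic

/-! ## The transport function and its invariances -/

section Transport

/-- Measurability of the weight `ω ↦ 1/|C_ℍ(a) ∩ ∂ℍ|`. [folklore] -/
theorem measurable_weight (a : Site 3) :
    Measurable fun ω : BondConfig (Site 3) => 𝐰𝐭[ω, a] := by
  have hset : Measurable fun ω : BondConfig (Site 3) =>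
      ({u : Site 3 | ω ∈ openConnIn (halfSpace 3) a u} ∩ {u : Site 3 | u 0 = 0}) := by
    refine measurable_set_iff.2 fun u => ?_
    exact (measurableSet_setOf.1 (measurableSet_openConnIn_of_countable (halfSpace 3) a u)).and
      measurable_const
  exact ((Measurable.of_discrete (f := fun n : ℕ∞ => (n : ℝ≥0∞))).comp
    (measurable_encard.comp hset)).inv

/-- Measurability of the transport function `ω ↦ 𝟙{y ↔ x + h e₀ in ℍ} / |C_ℍ(y) ∩ ∂ℍ|`. [folklore] -/
theorem measurable_transport (h : ℕ) (x y : Site 3) :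
    Measurable fun ω : BondConfig (Site 3) =>
      (openConnIn (halfSpace 3) y (x + 𝐏[h])).indicator (fun ω' => 𝐰𝐭[ω', y]) ω :=
  (measurable_weight y).indicator (measurableSet_openConnIn_of_countable _ _ _)

/-- Horizontal shifts preserve `ℍ`. [folklore] -/
theorem preimage_add_halfSpace {v : Site 3} (hv : v 0 = 0) :
    ((fun u : Site 3 => u + v) ⁻¹' halfSpace 3) = halfSpace 3 := by
  rw [BoundaryTwoArmDecay.StubCensus.halfSpace_eq, preimage_add_level, hv, sub_zero]

/-- The floor slice of the `ℍ`-cluster is covariant under horizontal shifts: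
`C_ℍ^{ω+v}(a + v) ∩ ∂ℍ = (C_ℍ^{ω}(a) ∩ ∂ℍ) + v`. [folklore] -/
theorem floorSlice_shift (ω : BondConfig (Site 3)) (a v : Site 3) (hv : v 0 = 0) :
    ({u : Site 3 | 𝑻[v] ω ∈ openConnIn (halfSpace 3) (a + v) u} ∩ {u : Site 3 | u 0 = 0}) =
      (fun u : Site 3 => u - v) ⁻¹'
        ({u : Site 3 | ω ∈ openConnIn (halfSpace 3) a u} ∩ {u : Site 3 | u 0 = 0}) := by
  ext u
  simp only [Set.mem_inter_iff, Set.mem_setOf_eq, Set.mem_preimage, Pi.sub_apply, hv, sub_zero]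
  have := shift_mem_openConnIn_iff v (halfSpace 3) ω a (u - v)
  rw [sub_add_cancel, preimage_add_halfSpace hv] at this
  rw [this]

/-- The weight is invariant under horizontal shifts. [folklore] -/
theorem weight_shift (ω : BondConfig (Site 3)) (a v : Site 3) (hv : v 0 = 0) :
    𝐰𝐭[𝑻[v] ω, a + v] = 𝐰𝐭[ω, a] := by
  rw [floorSlice_shift ω a v hv, Set.encard_preimage_of_injective_subset_range sub_left_injective
    (fun u _ => ⟨u + v, add_sub_cancel_right u v⟩)]

/-- **Diagonal invariance** of the transport function under horizontal shifts. [folklore] -/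
theorem transport_shift (h : ℕ) (ω : BondConfig (Site 3)) (x y v : Site 3) (hv : v 0 = 0) :
    (openConnIn (halfSpace 3) (y + v) (x + v + 𝐏[h])).indicator (fun ω' => 𝐰𝐭[ω', y + v]) (𝑻[v] ω) =
      (openConnIn (halfSpace 3) y (x + 𝐏[h])).indicator (fun ω' => 𝐰𝐭[ω', y]) ω := by
  have hmem : 𝑻[v] ω ∈ openConnIn (halfSpace 3) (y + v) (x + v + 𝐏[h]) ↔
      ω ∈ openConnIn (halfSpace 3) y (x + 𝐏[h]) := by
    rw [add_right_comm x v, shift_mem_openConnIn_iff v (halfSpace 3) ω y (x + 𝐏[h]),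
      preimage_add_halfSpace hv]
  by_cases hc : ω ∈ openConnIn (halfSpace 3) y (x + 𝐏[h])
  · rw [Set.indicator_of_mem (hmem.2 hc), Set.indicator_of_mem hc, weight_shift ω y v hv]
  · rw [Set.indicator_of_notMem (fun h' => hc (hmem.1 h')), Set.indicator_of_notMem hc]

end Transport

/-! ## The two evaluations of the transported mass -/

section Evaluations

/-- The wall-connection event `{h e₀ ↔ ∂ℍ in ℍ}` is measurable. [folklore] -/
theorem measurableSet_wallConn (h : ℕ) :
    MeasurableSet {ω : BondConfig (Site 3) | ∃ c : Site 3, c 0 = 0 ∧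
      ω ∈ openConnIn (halfSpace 3) (𝐏[h]) c} := by
  rw [Set.setOf_exists]
  exact MeasurableSet.iUnion fun c =>
    (show MeasurableSet {ω : BondConfig (Site 3) | c 0 = 0 ∧ ω ∈ openConnIn (halfSpace 3) (𝐏[h]) c}
      from by
        rw [Set.setOf_and]
        exact (MeasurableSet.const _).inter (measurableSet_openConnIn_of_countable _ _ _))

/-- **Mass received at the origin = indicator of the wall connection.**  If the `ℍ`-cluster `W` of
`h e₀` is finite, then `Σ_{y ∈ ∂ℍ} 𝟙{y ↔ h e₀ in ℍ}/|C_ℍ(y) ∩ ∂ℍ| = 𝟙{h e₀ ↔ ∂ℍ in ℍ}`: the non-zero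
terms are the floor points `y` of `W`, each with `C_ℍ(y) = W`, so they contribute `|W ∩ ∂ℍ|` times
`1/|W ∩ ∂ℍ|`. [folklore] -/
theorem tsum_transport_origin (h : ℕ) (ω : BondConfig (Site 3)) (hW : (𝐜𝐥[ω, 𝐏[h]]).Finite) :
    ∑' y : Site 3, {y : Site 3 | y 0 = 0}.indicator
        (fun y => (openConnIn (halfSpace 3) y (0 + 𝐏[h])).indicator (fun ω' => 𝐰𝐭[ω', y]) ω) y =
      {ω : BondConfig (Site 3) | ∃ c : Site 3, c 0 = 0 ∧
        ω ∈ openConnIn (halfSpace 3) (𝐏[h]) c}.indicator 1 ω := by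
  set F : Set (Site 3) := 𝐜𝐥[ω, 𝐏[h]] ∩ {u : Site 3 | u 0 = 0} with hFdef
  have hFfin : F.Finite := hW.subset Set.inter_subset_left
  -- termwise identification
  have hterm : ∀ y : Site 3, {y : Site 3 | y 0 = 0}.indicator
      (fun y => (openConnIn (halfSpace 3) y (0 + 𝐏[h])).indicator (fun ω' => 𝐰𝐭[ω', y]) ω) y =
      F.indicator (fun _ => (((F.encard : ℕ∞) : ℝ≥0∞))⁻¹) y := by
    intro y
    rw [zero_add]
    by_cases hyF : y ∈ F
    · obtain ⟨hyW, hy0⟩ := hyF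
      have hy0' : y 0 = 0 := hy0
      have hyW' : ω ∈ openConnIn (halfSpace 3) (𝐏[h]) y := hyW
      rw [Set.indicator_of_mem (show y ∈ {y : Site 3 | y 0 = 0} from hy0'),
        Set.indicator_of_mem (conn_symm hyW'), Set.indicator_of_mem (show y ∈ F from ⟨hyW, hy0⟩)]
      have hcl : 𝐜𝐥[ω, y] = 𝐜𝐥[ω, 𝐏[h]] := by
        ext u
        simp only [Set.mem_setOf_eq]
        exact ⟨fun hu => conn_trans hyW' hu, fun hu => conn_trans (conn_symm hyW') hu⟩
      rw [hcl]
    · rw [Set.indicator_of_notMem hyF]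
      by_cases hy0 : y 0 = 0
      · rw [Set.indicator_of_mem (show y ∈ {y : Site 3 | y 0 = 0} from hy0)]
        refine Set.indicator_of_notMem (fun hc => hyF ⟨?_, hy0⟩) _
        exact conn_symm hc
      · exact Set.indicator_of_notMem (show y ∉ {y : Site 3 | y 0 = 0} from hy0) _
  rw [tsum_congr hterm, ← tsum_subtype, ENNReal.tsum_set_const]
  by_cases hE : ω ∈ {ω : BondConfig (Site 3) | ∃ c : Site 3, c 0 = 0 ∧
      ω ∈ openConnIn (halfSpace 3) (𝐏[h]) c}
  · rw [Set.indicator_of_mem hE, Pi.one_apply]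
    obtain ⟨c, hc0, hc⟩ := hE
    have hN0 : ((F.encard : ℕ∞) : ℝ≥0∞) ≠ 0 := by
      rw [Ne, ENat.toENNReal_eq_zero, Set.encard_eq_zero]
      exact Set.Nonempty.ne_empty ⟨c, Set.mem_inter hc hc0⟩
    have hNtop : ((F.encard : ℕ∞) : ℝ≥0∞) ≠ ⊤ := by
      rw [Ne, ENat.toENNReal_eq_top]
      exact hFfin.encard_lt_top.ne
    exact ENNReal.mul_inv_cancel hN0 hNtop
  · rw [Set.indicator_of_notMem hE]
    have hF0 : F = ∅ := by
      refine Set.eq_empty_of_forall_notMem fun y hy => hE ⟨y, hy.2, hy.1⟩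
    rw [hF0, Set.encard_empty]
    simp

/-- **Mass sent from the origin = footprint-normalised level count.**
`Σ_{x ∈ ∂ℍ} 𝟙{0 ↔ x + h e₀ in ℍ}/|U ∩ ∂ℍ| = N_h(U)/|U ∩ ∂ℍ|`. [folklore] -/
theorem tsum_transport_level (h : ℕ) (ω : BondConfig (Site 3)) :
    ∑' x : Site 3, {x : Site 3 | x 0 = 0}.indicator
        (fun x => (openConnIn (halfSpace 3) 0 (x + 𝐏[h])).indicator (fun ω' => 𝐰𝐭[ω', 0]) ω) x =
      (((halfSpaceCluster ω ∩ {u : Site 3 | u 0 = (h : ℤ)}).encard : ℕ∞) : ℝ≥0∞) /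
        ((halfSpaceFootprint ω : ℕ∞) : ℝ≥0∞) := by
  set S : Set (Site 3) := {x : Site 3 | x 0 = 0} ∩ (fun x : Site 3 => x + 𝐏[h]) ⁻¹' halfSpaceCluster ω
    with hSdef
  have hwt0 : 𝐰𝐭[ω, 0] = (((halfSpaceFootprint ω : ℕ∞) : ℝ≥0∞))⁻¹ := rfl
  have hterm : ∀ x : Site 3, {x : Site 3 | x 0 = 0}.indicator
      (fun x => (openConnIn (halfSpace 3) 0 (x + 𝐏[h])).indicator (fun ω' => 𝐰𝐭[ω', 0]) ω) x =
      S.indicator (fun _ => (((halfSpaceFootprint ω : ℕ∞) : ℝ≥0∞))⁻¹) x := by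
    intro x
    by_cases hx0 : x 0 = 0
    · rw [Set.indicator_of_mem (show x ∈ {x : Site 3 | x 0 = 0} from hx0)]
      by_cases hc : ω ∈ openConnIn (halfSpace 3) 0 (x + 𝐏[h])
      · rw [Set.indicator_of_mem hc, Set.indicator_of_mem (show x ∈ S from ⟨hx0, hc⟩)]
        exact hwt0
      · rw [Set.indicator_of_notMem hc, Set.indicator_of_notMem (fun hx : x ∈ S => hc hx.2)]
    · rw [Set.indicator_of_notMem (show x ∉ {x : Site 3 | x 0 = 0} from hx0),
        Set.indicator_of_notMem (fun hx : x ∈ S => hx0 hx.1)]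
  rw [tsum_congr hterm, ← tsum_subtype, ENNReal.tsum_set_const, div_eq_mul_inv]
  congr 2
  have hS : S = (fun x : Site 3 => x + 𝐏[h]) ⁻¹' (halfSpaceCluster ω ∩ {u : Site 3 | u 0 = (h : ℤ)}) := by
    ext x
    simp only [hSdef, Set.mem_inter_iff, Set.mem_setOf_eq, Set.mem_preimage, Pi.add_apply,
      Pi.single_eq_same]
    constructor
    · rintro ⟨hx0, hx⟩
      exact ⟨hx, by rw [hx0, zero_add]⟩
    · rintro ⟨hx, hxh⟩
      exact ⟨by omega, hx⟩
  rw [hS, Set.encard_preimage_of_injective_subset_range (add_left_injective _)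
    (fun u _ => ⟨u - 𝐏[h], sub_add_cancel u _⟩)]

end Evaluations

/-! ## The point-to-wall identity -/

section Identity

/-- **Point-to-wall mass-transport identity.**  For bond percolation on `ℤ³` at `p ≤ p_c(ℤ³)` and every
height `h`,
`P_p(h e₀ ↔ ∂ℍ in ℍ) = ∫ N_h(U) / |U ∩ ∂ℍ| dP_p`,
where `U` is the half-space cluster of the origin, `N_h(U) = |U ∩ {x₀ = h}|` and `|U ∩ ∂ℍ|` its
footprint: send mass `1/|C_ℍ(y) ∩ ∂ℍ|` from every floor point `y` of the (a.s. finite, BGN) `ℍ`-cluster of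
`x + h e₀` to the floor point `x`; the mass-transport principle for the horizontal translations
(`stub_census_floorMTP`) equates the expected mass received at `0` (the indicator of the wall
connection) with the expected mass sent from `0` (the normalised level count). [folklore] -/
theorem measure_wallConn_eq_lintegral_levelCount (p : unitInterval) (hp : p ≤ criticalProbI 3) (h : ℕ) :
    bondPercolation (zdGraph 3) p {ω | ∃ c : Site 3, c 0 = 0 ∧
        ω ∈ openConnIn (halfSpace 3) (𝐏[h]) c} =
      ∫⁻ ω, (((halfSpaceCluster ω ∩ {u : Site 3 | u 0 = (h : ℤ)}).encard : ℕ∞) : ℝ≥0∞) /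
        ((halfSpaceFootprint ω : ℕ∞) : ℝ≥0∞) ∂(bondPercolation (zdGraph 3) p) := by
  rw [← lintegral_indicator_one (measurableSet_wallConn h)]
  have hP : (𝐏[h]) ∈ halfSpace 3 := by
    show (0 : ℤ) ≤ (Pi.single 0 (h : ℤ) : Site 3) 0
    simp
  -- received mass, almost surely
  have h1 : ∫⁻ ω, {ω : BondConfig (Site 3) | ∃ c : Site 3, c 0 = 0 ∧
      ω ∈ openConnIn (halfSpace 3) (𝐏[h]) c}.indicator 1 ω ∂(bondPercolation (zdGraph 3) p) =
      ∫⁻ ω, ∑' y : Site 3, {y : Site 3 | y 0 = 0}.indicator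
        (fun y => (openConnIn (halfSpace 3) y (0 + 𝐏[h])).indicator (fun ω' => 𝐰𝐭[ω', y]) ω) y
          ∂(bondPercolation (zdGraph 3) p) := by
    refine lintegral_congr_ae ?_
    filter_upwards [ae_forall_finite_halfSpaceCluster_shift p hp] with ω hω
    exact (tsum_transport_origin h ω (finite_cl_halfSpace hω hP)).symm
  rw [h1, BoundaryTwoArmDecay.stub_census_floorMTP p
    (fun ω x y => (openConnIn (halfSpace 3) y (x + 𝐏[h])).indicator (fun ω' => 𝐰𝐭[ω', y]) ω)
    (fun x y => measurable_transport h x y) (fun ω x y v hv => transport_shift h ω x y v hv)]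
  exact lintegral_congr fun ω => tsum_transport_level h ω

end Identity

/-! ## Registered form -/

/-- **Registered stub `stub_pointToWallIdentity`** (crux stmt-CriticalPhenomena-14713): the point-to-wall
identity `P_p(h e₀ ↔ ∂ℍ in ℍ) = E_p[N_h(U)/|U ∩ ∂ℍ|]` for `p ≤ p_c(ℤ³)`, verbatim the registered
signature. [folklore] -/
theorem stub_pointToWallIdentity : ∀ p : unitInterval, p ≤ criticalProbI 3 → ∀ h : ℕ, bondPercolation (zdGraph 3) p {ω | ∃ c : Site 3, c 0 = 0 ∧ ω ∈ openConnIn (halfSpace 3) (Pi.single 0 (h : ℤ) : Site 3) c} = ∫⁻ ω, (((halfSpaceCluster ω ∩ {u : Site 3 | u 0 = (h : ℤ)}).encard : ℕ∞) : ENNReal) / ((halfSpaceFootprint ω : ℕ∞) : ENNReal) ∂(bondPercolation (zdGraph 3) p) :=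
  fun p hp h => measure_wallConn_eq_lintegral_levelCount p hp h

end LowPoint

end Summit.CriticalPhenomena.PercolationContinuityZ3.Theorems

end
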